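import Summits.CriticalPhenomena.PercolationContinuityZ3.Theorems.SahiMasterFamilyUCBernsteinNested
import Summits.CriticalPhenomena.PercolationContinuityZ3.Theorems.SahiMasterFamilyUCBernstein
import Mathlib.Algebra.Polynomial.Roots

/-!
# The layer sums of conjecture (B) are nonnegative for every pair of union-closed families with the disjoint-union condition, every order:
# `BPos` ⇒ `layerSum ≥ 0` via the uniqueness of the Bernstein representation (the typed conjecture `UCBernsteinNonneg`, two-family slice)

Unit `prim-masterthm-p4` (gen 22; crux anchor stmt-CriticalPhenomena-4575, helper work; memo
`run/shared/lean/prim/prim-masterthm/prim-masterthm-p4/P4-GEN22-REPORT.md` §2).  Bridge between `…UCBernsteinNested` (the edge polynomial of a pair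
`𝒰, 𝒱` of union-closed families with the disjoint-union condition — e.g. union-closed union — is `BPos (n+1)`: a nonnegative combination of `w^p(1−w)^q`, `p + q ≤ n+1`) and the typed
conjecture (B) of `…UCBernstein` (`layerSum 𝒰 j ≥ 0` for every type `j`: the degree-`(n+1)` Bernstein coefficients of the mixture polynomial, defined
through the PATCHWORK decomposition).

**THEOREM** `layerSum_nonneg_of_disjointUnion`: for a `Bool`-indexed pair of union-closed families `𝒰_b` of subsets of `Fin (n+1)` with
`A ∈ 𝒰_true, B ∈ 𝒰_false, A ∩ B = ∅ ⇒ A ∪ B ∈ 𝒰_true ∪ 𝒰_false` (no top condition) and every type `j : Bool → ℕ`, `0 ≤ layerSum 𝒰 j` — conjecture (B)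
(`UCBernsteinNonneg`) holds on this class of two-family mixtures (union-closed unions `layerSum_nonneg_of_unionClosed_union`, nested pairs, pairs of
up-sets, rays, segments; 75.4 % of all ordered pairs on 4 points).
INGREDIENTS: (1) `bernstein_coeff_nonneg_of_bpos` — if `f` is `BPos d` and also `f(w) = Σ_{s ≤ d} L_s w^{d−s}(1−w)^s` identically, then every `L_s ≥ 0`:
substitute `w = (1+x)⁻¹`, clear `(1+x)^{-d}`; both sides become honest polynomials in `x` (`Σ_s L_s x^s` and `Σ_i a_i x^{q_i}(1+x)^{d−p_i−q_i}`) that agree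
off `x = −1`, hence coincide (`Polynomial.eq_zero_of_infinite_isRoot`), and the coefficients of `x^q(1+x)^m` are binomial, `≥ 0`;
(2) `phiSet_mix_eq_sum_layerSum` — the patchwork decomposition (`UCBernstein.phiSet_mixture_eq_sum_patchwork`) for `α = Bool`, grouped by the number
`s` of `false` labels: `Φ_{n+1}(mix 𝒰 𝒱 w) = Σ_{s ≤ n+1} layerSum(j_s)·w^{n+1−s}(1−w)^s`, `j_s = (true ↦ n+1−s, false ↦ s)` (other types have empty layers).
HONEST FRAMING: (B) for general pairs / families, `UCHullNonneg k` (k ≥ 8), Sahi's `C_k` and the master theorem remain OPEN.  Axioms standard. [this work]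
-/

noncomputable section

open scoped Classical

namespace Summit.CriticalPhenomena.PercolationContinuityZ3.Theorems

namespace UCBernsteinNested

open Finset Function
open Literature.Combinatorics.Sahi2008
open PrincipalCapBeta (phiSet)
open BernsteinPos
open Polynomial

variable {n : ℕ}

/-! ### Uniqueness of the Bernstein representation: `BPos` forces nonnegative degree-`d` Bernstein coefficients -/

/-- The substitution `w = (1+x)⁻¹`: `w^a (1−w)^b = x^b · ((1+x)⁻¹)^(a+b)`. [folklore] -/
theorem subst_monomial {x : ℝ} (hx : 1 + x ≠ 0) (a b : ℕ) :
    ((1 + x)⁻¹) ^ a * (1 - (1 + x)⁻¹) ^ b = x ^ b * ((1 + x)⁻¹) ^ (a + b) := by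
  have h1 : 1 - (1 + x)⁻¹ = x * (1 + x)⁻¹ := by field_simp; ring
  rw [h1, mul_pow, pow_add]
  ring

/-- **Nonnegativity of Bernstein coefficients from `BPos`.**  If `f` is a nonnegative combination of `w^p(1−w)^q` (`p+q ≤ d`) and also
`f(w) = Σ_{s ≤ d} L_s w^{d−s}(1−w)^s` for all real `w`, then `L_s ≥ 0` for every `s ≤ d`. [this work] -/
theorem bernstein_coeff_nonneg_of_bpos {d : ℕ} {f : ℝ → ℝ} (hf : BPos d f) (L : ℕ → ℝ)
    (hL : ∀ w, f w = ∑ s ∈ range (d + 1), L s * (w ^ (d - s) * (1 - w) ^ s)) : ∀ s ≤ d, 0 ≤ L s := by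
  obtain ⟨ι, hι, a, p, q, ha, hpq, hf⟩ := hf
  -- the two polynomials in `x`
  let Q : ℝ[X] := ∑ s ∈ range (d + 1), C (L s) * X ^ s
  let R : ℝ[X] := ∑ i, C (a i) * (X ^ (q i) * (1 + X) ^ (d - p i - q i))
  have hQR : ∀ x : ℝ, 1 + x ≠ 0 → Q.eval x = R.eval x := by
    intro x hx
    have hu : ((1 + x)⁻¹) ^ d ≠ 0 := pow_ne_zero _ (inv_ne_zero hx)
    have e := (hL ((1 + x)⁻¹)).symm.trans (hf ((1 + x)⁻¹))
    -- left side: `u^d · Q(x)`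
    have eQ : ∑ s ∈ range (d + 1), L s * (((1 + x)⁻¹) ^ (d - s) * (1 - (1 + x)⁻¹) ^ s) =
        ((1 + x)⁻¹) ^ d * Q.eval x := by
      simp only [Q, eval_finsetSum, eval_mul, eval_C, eval_pow, eval_X, mul_sum]
      refine sum_congr rfl fun s hs => ?_
      have hsd : s ≤ d := Nat.lt_succ_iff.mp (mem_range.mp hs)
      rw [subst_monomial hx, Nat.sub_add_cancel hsd]
      ring
    -- right side: `u^d · R(x)`
    have eR : ∑ i, a i * (((1 + x)⁻¹) ^ (p i) * (1 - (1 + x)⁻¹) ^ (q i)) = ((1 + x)⁻¹) ^ d * R.eval x := by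
      simp only [R, eval_finsetSum, eval_mul, eval_C, eval_pow, eval_X, eval_add, eval_one, mul_sum]
      refine sum_congr rfl fun i _ => ?_
      have hpow : ((1 + x)⁻¹) ^ d = ((1 + x)⁻¹) ^ (d - p i - q i) * ((1 + x)⁻¹) ^ (p i + q i) := by
        rw [← pow_add]; congr 1; have := hpq i; omega
      have hinv : ((1 + x)⁻¹) ^ (d - p i - q i) * (1 + x) ^ (d - p i - q i) = 1 := by
        rw [← mul_pow, inv_mul_cancel₀ hx, one_pow]
      rw [subst_monomial hx, hpow]
      calc a i * (x ^ q i * (1 + x)⁻¹ ^ (p i + q i))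
          = a i * (x ^ q i * (1 + x)⁻¹ ^ (p i + q i)) * (((1 + x)⁻¹) ^ (d - p i - q i) * (1 + x) ^ (d - p i - q i)) := by
            rw [hinv, mul_one]
        _ = (1 + x)⁻¹ ^ (d - p i - q i) * (1 + x)⁻¹ ^ (p i + q i) * (a i * (x ^ q i * (1 + x) ^ (d - p i - q i))) := by ring
    rw [eQ, eR] at e
    exact mul_left_cancel₀ hu e
  -- `Q = R` as polynomials: they agree off `-1`
  have hQReq : Q = R := by
    have h0 : Q - R = 0 := by
      refine Polynomial.eq_zero_of_infinite_isRoot _ ?_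
      refine Set.Infinite.mono (s := ({-1} : Set ℝ)ᶜ) (fun x hx => ?_) ((Set.finite_singleton (-1 : ℝ)).infinite_compl)
      have hx' : 1 + x ≠ 0 := fun h => (Set.mem_compl_singleton_iff.mp hx) (by linarith)
      show (Q - R).eval x = 0
      rw [eval_sub, hQR x hx', sub_self]
    exact sub_eq_zero.mp h0
  -- compare coefficients
  intro s hs
  have hcoef : L s = R.coeff s := by
    have h1 : Q.coeff s = L s := by
      simp only [Q, finsetSum_coeff, coeff_C_mul_X_pow]
      rw [sum_ite_eq (range (d + 1)) s L, if_pos (mem_range.mpr (Nat.lt_succ_of_le hs))]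
    rw [← h1, hQReq]
  rw [hcoef]
  simp only [R, finsetSum_coeff, coeff_C_mul]
  refine sum_nonneg fun i _ => mul_nonneg (ha i) ?_
  rw [coeff_X_pow_mul']
  split_ifs
  · rw [coeff_one_add_X_pow]; exact Nat.cast_nonneg _
  · exact le_rfl

/-! ### The patchwork decomposition for two families, grouped by the number of `false` labels -/

/-- The two label counts of a `Bool`-labelling add up to the number of elements. [this work] -/
theorem ltype_true_add_false (ℓ : Fin n → Bool) : UCBernstein.ltype ℓ true + UCBernstein.ltype ℓ false = n := by
  unfold UCBernstein.ltype
  have h := Finset.card_filter_add_card_filter_not (s := (univ : Finset (Fin n))) (fun i => ℓ i = true)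
  rw [card_univ, Fintype.card_fin] at h
  convert h using 4
  simp

/-- **`Φ_{n+1}(mix 𝒰 𝒱 w) = Σ_{s ≤ n+1} N_{(n+1−s, s)} · w^{n+1−s}(1−w)^s`**, `N_j = layerSum` of the `Bool`-indexed pair (`true ↦ 𝒰`, weight `w`;
`false ↦ 𝒱`, weight `1−w`) — the patchwork decomposition grouped by the number `s` of `false` labels. [this work] -/
theorem phiSet_mix_eq_sum_layerSum (𝒰 𝒱 : Finset (Finset (Fin (n + 1)))) (w : ℝ) :
    phiSet (n + 1) (mix 𝒰 𝒱 w) = ∑ s ∈ range (n + 2),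
      UCBernstein.layerSum (fun b : Bool => if b then 𝒰 else 𝒱) (fun b => if b then n + 1 - s else s) *
        (w ^ (n + 1 - s) * (1 - w) ^ s) := by
  set F : Bool → Finset (Finset (Fin (n + 1))) := fun b => if b then 𝒰 else 𝒱 with hF
  set wB : Bool → ℝ := fun b => if b then w else 1 - w with hwB
  have hw1 : ∑ b, wB b = 1 := by rw [Fintype.sum_bool]; simp only [hwB]; norm_num
  have hmix : (fun S : Finset (Fin (n + 1)) => ∑ x, wB x * (if S ∈ F x then (1 : ℝ) else 0)) = mix 𝒰 𝒱 w := by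
    funext S
    rw [Fintype.sum_bool]
    simp only [hwB, hF, mix, if_true]
    rfl
  rw [← hmix, UCBernstein.phiSet_mixture_eq_sum_patchwork wB hw1 F]
  rw [← Finset.sum_fiberwise_of_maps_to (s := (univ : Finset (Fin (n + 1) → Bool))) (t := range (n + 2))
    (g := fun ℓ => UCBernstein.ltype ℓ false) (fun ℓ _ => ?_)]
  · refine sum_congr rfl fun s _ => ?_
    unfold UCBernstein.layerSum
    rw [mul_comm, mul_sum]
    have hfilt : (univ : Finset (Fin (n + 1) → Bool)).filter (fun ℓ => UCBernstein.ltype ℓ false = s) =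
        univ.filter fun ℓ => UCBernstein.ltype ℓ = fun b => if b then n + 1 - s else s := by
      ext ℓ
      simp only [mem_filter, mem_univ, true_and]
      constructor
      · intro h
        funext b
        cases b
        · exact h
        · have h2 := ltype_true_add_false ℓ
          show UCBernstein.ltype ℓ true = n + 1 - s
          omega
      · intro h
        have := congrFun h false
        simpa using this
    rw [hfilt]
    refine sum_congr rfl fun ℓ hℓ => ?_
    have hty : UCBernstein.ltype ℓ = fun b => if b then n + 1 - s else s := (mem_filter.1 hℓ).2
    rw [UCBernstein.prod_label_eq_prod_pow, Fintype.prod_bool, hty]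
    simp only [hwB, if_true]
    rfl
  · have h := ltype_true_add_false ℓ
    exact mem_range.2 (by omega)

/-! ### (B) on the class: layer sums are nonnegative -/

/-- A type whose entries do not add up to the number of elements has an empty layer. [this work] -/
theorem layerSum_eq_zero_of_ne (F : Bool → Finset (Finset (Fin (n + 1)))) (j : Bool → ℕ) (hj : j true + j false ≠ n + 1) :
    UCBernstein.layerSum F j = 0 := by
  unfold UCBernstein.layerSum
  refine sum_eq_zero fun ℓ hℓ => ?_
  have hty : UCBernstein.ltype ℓ = j := (mem_filter.1 hℓ).2
  have h := ltype_true_add_false ℓ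
  rw [hty] at h
  exact absurd h hj

/-- **(B) for pairs with the disjoint-union condition, in the language of `…UCBernstein`**: for a `Bool`-indexed pair of union-closed families with
`A ∈ F true, B ∈ F false, A ∩ B = ∅ ⇒ A ∪ B ∈ F true ∪ F false` (no top condition), every layer sum is nonnegative, every order. [this work] -/
theorem layerSum_nonneg_of_disjointUnion (F : Bool → Finset (Finset (Fin (n + 1))))
    (hUC : ∀ b, ∀ A ∈ F b, ∀ B ∈ F b, A ∪ B ∈ F b)
    (hD : ∀ A ∈ F true, ∀ B ∈ F false, Disjoint A B → A ∪ B ∈ F true ∪ F false) (j : Bool → ℕ) :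
    0 ≤ UCBernstein.layerSum F j := by
  have hFeq : F = fun b : Bool => if b then F true else F false := by
    funext b; cases b <;> rfl
  by_cases hj : j true + j false = n + 1
  · have hjs : j = fun b => if b then n + 1 - j false else j false := by
      funext b; cases b
      · rfl
      · show j true = n + 1 - j false
        omega
    have key := bernstein_coeff_nonneg_of_bpos
      (bpos_phiSet_mix_of_disjointUnion n (F true) (F false) (hUC true) (hUC false) hD)
      (fun s => UCBernstein.layerSum (fun b : Bool => if b then F true else F false) (fun b => if b then n + 1 - s else s))
      (fun w => phiSet_mix_eq_sum_layerSum (F true) (F false) w) (j false) (by omega)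
    rw [hFeq, hjs]
    exact key
  · rw [layerSum_eq_zero_of_ne F j hj]

/-- **(B) for pairs with union-closed union** (layer sums). [this work] -/
theorem layerSum_nonneg_of_unionClosed_union (F : Bool → Finset (Finset (Fin (n + 1))))
    (hUC : ∀ b, ∀ A ∈ F b, ∀ B ∈ F b, A ∪ B ∈ F b)
    (hH : ∀ A ∈ F true ∪ F false, ∀ B ∈ F true ∪ F false, A ∪ B ∈ F true ∪ F false) (j : Bool → ℕ) :
    0 ≤ UCBernstein.layerSum F j :=
  layerSum_nonneg_of_disjointUnion F hUC (disjointUnion_of_unionClosed_union hH) j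

/-- The same for a pair given as two families: nested pairs, pairs of up-sets, … [this work] -/
theorem layerSum_pair_nonneg (𝒰 𝒱 : Finset (Finset (Fin (n + 1)))) (hU : ∀ A ∈ 𝒰, ∀ B ∈ 𝒰, A ∪ B ∈ 𝒰)
    (hV : ∀ A ∈ 𝒱, ∀ B ∈ 𝒱, A ∪ B ∈ 𝒱) (hD : ∀ A ∈ 𝒰, ∀ B ∈ 𝒱, Disjoint A B → A ∪ B ∈ 𝒰 ∪ 𝒱) (j : Bool → ℕ) :
    0 ≤ UCBernstein.layerSum (fun b : Bool => if b then 𝒰 else 𝒱) j :=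
  layerSum_nonneg_of_disjointUnion _ (fun b => by cases b <;> assumption) hD j

/-- **Nested pairs**: `𝒰 ⊆ 𝒱` union-closed ⇒ every layer sum of conjecture (B) for the pair is `≥ 0`. [this work] -/
theorem layerSum_nonneg_of_nested (𝒰 𝒱 : Finset (Finset (Fin (n + 1)))) (hU : ∀ A ∈ 𝒰, ∀ B ∈ 𝒰, A ∪ B ∈ 𝒰)
    (hV : ∀ A ∈ 𝒱, ∀ B ∈ 𝒱, A ∪ B ∈ 𝒱) (hUV : 𝒰 ⊆ 𝒱) (j : Bool → ℕ) :
    0 ≤ UCBernstein.layerSum (fun b : Bool => if b then 𝒰 else 𝒱) j := by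
  refine layerSum_pair_nonneg 𝒰 𝒱 hU hV (disjointUnion_of_unionClosed_union ?_) j
  rw [union_eq_right.2 hUV]
  exact hV

end UCBernsteinNested

end Summit.CriticalPhenomena.PercolationContinuityZ3.Theorems
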